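import Mathlib
import HarnessLib
import Summits.NavierStokesRegularity.NavierStokesRegularity.Theorems.PoloidalWindowDoorLrcModEntireQ4SonicSheetNonHot
import Summits.NavierStokesRegularity.NavierStokesRegularity.Theorems.PoloidalWindowDoorLrcModEntireQ4SonicHotSheetTimeSplit
import Summits.NavierStokesRegularity.NavierStokesRegularity.Theorems.PoloidalWindowDoorLrcModEntireSheetTransport
import Summits.NavierStokesRegularity.NavierStokesRegularity.Theorems.PoloidalWindowDoorLrcModEntireRidgeClassConstants
import Summits.NavierStokesRegularity.NavierStokesRegularity.Theorems.PoloidalWindowDoorPoloidalWindowRigidityTimeHeightShearLinearSlice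
import Summits.NavierStokesRegularity.NavierStokesRegularity.Theorems.PoloidalWindowDoorPoloidalWindowRigidityConstantShearSlice
import Summits.NavierStokesRegularity.NavierStokesRegularity.Theorems.LocalSineTubeDoorProfileAlignedWindowRigidityAncient

/-!
# Route `PoloidalWindowDoor`, item `LrcModEntire` (stmt-NavierStokesRegularity-20428), cell (Q4-sonic), slot `stub_Q4sonicLineNeg` —
# S2 OF THE ASSEMBLY A-I: THE SHEET GEOMETRY AT A SONIC TIME WITH PARALLEL WEBS, IN THE CURRENCY OF THE SPACE–TIME WEB PACKAGE

Cell ns-regularity-ideate, helper seat ns-k2-port-2 g8 under the LEAD of item 20428 (ns-poloidal-K2-p3 g17, memo `T2B-g17.md` v4 §7 «S2 (sheet geometry at every τ;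
port-2 bricks)»); `--supports stmt-NavierStokesRegularity-20428 --as helper`.

* ★★ `sonic_sheet_data_of_package` — hypotheses: the class profile, `σ = ±1`, the (TH) slab law (`|t+1| < ρ`, `|x₂| < ρ`, `C³` slope), THE OUTPUT BLOCK OF
  `…Q4TimeWebPackage.time_web_package_line` for a given window `δ′ ≤ ρ`, `δ′ < 1/2`, web function `n₀` and ridge curvature `κ` (verbatim, with a horizontal unit vector `e`
  for `Γ′(0)`), a time `|τ| < δ′` which is SONIC (`R(τ,·)` affine on `|z| < δ′`) and at which the webs are PARALLEL (`n₀(τ,s,z) = n₀(τ,0,z)` — K2-p2's brick B-T).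
  Conclusions at every web point `W = frameCLM e (s, n₀(τ,s,z), z)`, `|z| < δ′`, with `t = −1+τ`, `θ = U₂(t,·)`, `d = n₀(τ,0,·)`, `a = D²θ(W)[Je,Je]`:
  (i) `W = s·e + d(z)·Je + z·e₂`; (ii) `d′(z)² + μ(t,z) = 0` (CHARACTERISTIC); (iii) `Dθ(W)[w] = σ·∂_zR(τ,z)·w₂` (`∇U₂∘W_τ = (0,0,σB(τ))`); (iv) `D²θ(W)[e,·] = 0` and
  (v) `D²θ(W)[d′(z)Je + e₂,·] = 0` (both sheet tangents are null); (vi) **`σ·a = −κ(τ,z)`** (`a` is `s`-free and `≠ 0`); (vii) the TRANSPORT LAW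
  `∂_z(d′·a²) = 0` along the web at time `t` (`…SheetTransport.transport_on_characteristic_sheet`); (viii) `U₂(t,W) = σR(τ,z)` and `∂_zU_b(t,W) = 0` (`b = 0,1`; slab law ×
  horizontal criticality).
WHAT THIS IS NOT: not a claim about Navier–Stokes regularity — identities of the (TH) column in case I («every nearby time sonic») of the research slot `stub_Q4sonicLineNeg`
(registry twist_split v12); no stub is closed here; items 20428 / 19708 / 27893 OPEN.
-/

noncomputable section

set_option linter.dupNamespace false
set_option linter.style.longLine false

namespace Summit.NavierStokesRegularity.NavierStokesRegularity.Theorems.PoloidalWindowDoorLrcModEntireQ4SonicSheetDataPackage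

open Set Function Filter Topology Metric
open scoped RealInnerProductSpace InnerProductSpace Laplacian ContDiff
open Literature.Analysis Literature.Analysis.FluidPDE Literature.Analysis.UnboundedOperators
open Summit.NavierStokesRegularity.NavierStokesRegularity.Theorems
open Summit.NavierStokesRegularity.NavierStokesRegularity.Theorems.LocalSineTubeDoorProfileAlignedWindowRigidityAncient
open Summit.NavierStokesRegularity.NavierStokesRegularity.Theorems.PoloidalWindowDoorPoloidalWindowRigidityWindow
open Summit.NavierStokesRegularity.NavierStokesRegularity.Theorems.PoloidalWindowDoorPoloidalWindowRigidityTimeHeightShearLinearSlice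
open Summit.NavierStokesRegularity.NavierStokesRegularity.Theorems.PoloidalWindowDoorPoloidalWindowRigidityConstantShearSlice
open Summit.NavierStokesRegularity.NavierStokesRegularity.Theorems.PoloidalWindowDoorLrcModEntireSheetFlattenTools
open Summit.NavierStokesRegularity.NavierStokesRegularity.Theorems.PoloidalWindowDoorLrcModEntireSheetTransport
open Summit.NavierStokesRegularity.NavierStokesRegularity.Theorems.PoloidalWindowDoorLrcModEntireParallelWebsIdentity
open Summit.NavierStokesRegularity.NavierStokesRegularity.Theorems.PoloidalWindowDoorLrcModEntireRidgeClassConstants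
open Summit.NavierStokesRegularity.NavierStokesRegularity.Theorems.PoloidalWindowDoorLrcModEntireQ4SonicHotSheetSecondPins
open Summit.NavierStokesRegularity.NavierStokesRegularity.Theorems.PoloidalWindowDoorLrcModEntireQ4SonicHotSheetTimeSplit
open Summit.NavierStokesRegularity.NavierStokesRegularity.Theorems.PoloidalWindowDoorLrcModEntireQ4SonicSheetNonHot

variable {C : ℝ} {U : ℝ → EuclideanSpace ℝ (Fin 3) → EuclideanSpace ℝ (Fin 3)} {R μ : ℝ → ℝ → ℝ} {σ r ρ δ' : ℝ} {e : EuclideanSpace ℝ (Fin 3)}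
  {n₀ : ℝ × ℝ × ℝ → ℝ} {κt : ℝ → ℝ → ℝ}

/-- ★★ **S2: THE SHEET GEOMETRY AT A SONIC TIME WITH PARALLEL WEBS (package currency).**  See the module docstring for the hypotheses and the eight conclusions
(i)–(viii), at the web point `W = frameCLM e (s, n₀(τ,s,z), z)`, `|z| < δ′`, `t = −1+τ`, `θ = U₂(t,·)`, `d = n₀(τ,0,·)`. -/
theorem sonic_sheet_data_of_package
    (hrate : HasTypeITimeDecay C U) (hcont : ContinuousOn (uncurry U) (Iio (0 : ℝ) ×ˢ univ))
    (hmild : ∀ s t : ℝ, s < t → t < 0 → ∀ x, U t x = heatExtension (U s) (t - s) x - oseenDuhamel 1 s U U t x)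
    (hdiv : ∀ t < 0, VectorCalculus.IsDivFree (U t))
    (hσ : σ = 1 ∨ σ = -1) (hμ3 : ContDiff ℝ 3 (uncurry μ))
    (hslabU : ∀ t : ℝ, |t + 1| < ρ → ∀ x : EuclideanSpace ℝ (Fin 3), |x 2| < ρ → ∀ b : Fin 3, b ≠ 2 →
      fderiv ℝ (U t) x (EuclideanSpace.single 2 1) b = μ t (x 2) * fderiv ℝ (U t) x (EuclideanSpace.single b 1) 2)
    (hδ'ρ : δ' ≤ ρ) (hδ'h : δ' < 1 / 2) (he2 : e 2 = 0) (hunit : e 0 ^ 2 + e 1 ^ 2 = 1)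
    (hpack : ∀ q : ℝ × ℝ × ℝ, |q.1| < δ' → |q.2.2| < δ' →
        n₀ q ∈ Ioo (-r) r ∧
        σ * U (-1 + q.1) (frameCLM e (q.2.1, n₀ q, q.2.2)) 2 = R q.1 q.2.2 ∧
        (∀ n ∈ Icc (-r) r, n ≠ n₀ q → σ * U (-1 + q.1) (frameCLM e (q.2.1, n, q.2.2)) 2 < R q.1 q.2.2) ∧
        (∀ w : EuclideanSpace ℝ (Fin 3), w 2 = 0 → fderiv ℝ (fun y => U (-1 + q.1) y 2) (frameCLM e (q.2.1, n₀ q, q.2.2)) w = 0) ∧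
        (∀ m : ℕ∞, ContDiffAt ℝ m n₀ q) ∧
        0 < κt q.1 q.2.2 ∧
        fderiv ℝ (fderiv ℝ (fun y => σ * U (-1 + q.1) y 2)) (frameCLM e (q.2.1, n₀ q, q.2.2)) e e +
            fderiv ℝ (fderiv ℝ (fun y => σ * U (-1 + q.1) y 2)) (frameCLM e (q.2.1, n₀ q, q.2.2)) (Jvec e) (Jvec e) =
          -κt q.1 q.2.2 ∧
        κt q.1 q.2.2 * (fderiv ℝ n₀ q ((0 : ℝ), (0 : ℝ), (1 : ℝ))) ^ 2 =
          (deriv (deriv (R q.1)) q.2.2 - μ (-1 + q.1) q.2.2 * κt q.1 q.2.2) * (1 + (fderiv ℝ n₀ q ((0 : ℝ), (1 : ℝ), (0 : ℝ))) ^ 2))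
    {τ : ℝ} (hτ : |τ| < δ') (hson : ∃ A B : ℝ, ∀ z : ℝ, |z| < δ' → R τ z = A + B * z)
    (hpar : ∀ s z : ℝ, |z| < δ' → n₀ (τ, s, z) = n₀ (τ, (0 : ℝ), z)) (s : ℝ) {z : ℝ} (hz : |z| < δ') :
    frameCLM e (s, n₀ (τ, s, z), z) = s • e + n₀ (τ, (0 : ℝ), z) • Jvec e + z • e2 ∧
      deriv (fun z' => n₀ (τ, (0 : ℝ), z')) z ^ 2 + μ (-1 + τ) z = 0 ∧
      (∀ w : EuclideanSpace ℝ (Fin 3), fderiv ℝ (fun y => U (-1 + τ) y 2) (frameCLM e (s, n₀ (τ, s, z), z)) w = σ * deriv (R τ) z * w 2) ∧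
      (∀ w : EuclideanSpace ℝ (Fin 3), fderiv ℝ (fderiv ℝ (fun y => U (-1 + τ) y 2)) (frameCLM e (s, n₀ (τ, s, z), z)) e w = 0) ∧
      (∀ w : EuclideanSpace ℝ (Fin 3), fderiv ℝ (fderiv ℝ (fun y => U (-1 + τ) y 2)) (frameCLM e (s, n₀ (τ, s, z), z))
        (deriv (fun z' => n₀ (τ, (0 : ℝ), z')) z • Jvec e + e2) w = 0) ∧
      σ * fderiv ℝ (fderiv ℝ (fun y => U (-1 + τ) y 2)) (frameCLM e (s, n₀ (τ, s, z), z)) (Jvec e) (Jvec e) = -κt τ z ∧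
      HasDerivAt (fun z' : ℝ => deriv (fun z'' => n₀ (τ, (0 : ℝ), z'')) z' *
          (fderiv ℝ (fderiv ℝ (fun y => U (-1 + τ) y 2)) (s • e + n₀ (τ, (0 : ℝ), z') • Jvec e + z' • e2) (Jvec e) (Jvec e)) ^ 2) 0 z ∧
      U (-1 + τ) (frameCLM e (s, n₀ (τ, s, z), z)) 2 = σ * R τ z ∧
      (∀ b : Fin 3, b ≠ 2 → fderiv ℝ (U (-1 + τ)) (frameCLM e (s, n₀ (τ, s, z), z)) (EuclideanSpace.single 2 1) b = 0) := by
  set t : ℝ := -1 + τ with ht_def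
  have hτh : |τ| < 1 / 2 := lt_of_lt_of_le hτ hδ'h.le
  have ht : t < 0 := by rw [ht_def]; linarith [(abs_lt.1 hτh).2]
  set θ : EuclideanSpace ℝ (Fin 3) → ℝ := fun y => U t y 2 with hθ_def
  set d : ℝ → ℝ := fun z' => n₀ (τ, (0 : ℝ), z') with hd_def
  set I : Set ℝ := Ioo (-δ') δ' with hI_def
  have hI : IsOpen I := isOpen_Ioo
  have hImem : ∀ {z' : ℝ}, |z'| < δ' → z' ∈ I := fun hz' => by rw [hI_def, mem_Ioo]; exact ⟨by linarith [(abs_lt.1 hz').1], (abs_lt.1 hz').2⟩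
  have hIabs : ∀ {z' : ℝ}, z' ∈ I → |z'| < δ' := fun hz' => by rw [hI_def, mem_Ioo] at hz'; exact abs_lt.2 ⟨by linarith [hz'.1], hz'.2⟩
  /- regularity -/
  have hUan : AnalyticOnNhd ℝ (U t) univ := analyticOnNhd_slice hcont (bdd_of_hasTypeITimeDecay hrate) hmild ht
  have hθan : AnalyticOnNhd ℝ θ univ := fun x _ => ((EuclideanSpace.proj (𝕜 := ℝ) (2 : Fin 3)).analyticAt _).comp (hUan x (mem_univ _))
  have hθ : ContDiff ℝ ∞ θ := hθan.contDiff
  have hθ2 : ContDiff ℝ 2 θ := hθ.of_le (by norm_cast)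
  have hθd : Differentiable ℝ θ := hθ.differentiable (by simp)
  have hn₀d : ∀ s' z' : ℝ, |z'| < δ' → DifferentiableAt ℝ n₀ (τ, s', z') := fun s' z' hz' =>
    ((hpack (τ, s', z') hτ hz').2.2.2.2.1 1).differentiableAt (by simp)
  have hWeq : ∀ s' z' : ℝ, |z'| < δ' → frameCLM e (s', n₀ (τ, s', z'), z') = s' • e + d z' • Jvec e + z' • e2 := by
    intro s' z' hz'
    rw [frameCLM_apply, hpar s' z' hz']
  have hdz : ∀ s' z' : ℝ, |z'| < δ' → HasDerivAt (fun a : ℝ => n₀ (τ, s', a)) (fderiv ℝ n₀ (τ, s', z') ((0 : ℝ), (0 : ℝ), (1 : ℝ))) z' :=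
    fun s' z' hz' => (hn₀d s' z' hz').hasFDerivAt.comp_hasDerivAt z' (hasDerivAt_zLine τ s' z')
  have hdd : ∀ z' : ℝ, |z'| < δ' → HasDerivAt d (fderiv ℝ n₀ (τ, (0 : ℝ), z') ((0 : ℝ), (0 : ℝ), (1 : ℝ))) z' := fun z' hz' => hdz 0 z' hz'
  have hns : fderiv ℝ n₀ (τ, (0 : ℝ), z) ((0 : ℝ), (1 : ℝ), (0 : ℝ)) = 0 := by
    have h1 : HasDerivAt (fun a : ℝ => n₀ (τ, a, z)) (fderiv ℝ n₀ (τ, (0 : ℝ), z) ((0 : ℝ), (1 : ℝ), (0 : ℝ))) 0 :=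
      (hn₀d 0 z hz).hasFDerivAt.comp_hasDerivAt (0 : ℝ) (hasDerivAt_sLine τ z 0)
    have h2 : HasDerivAt (fun a : ℝ => n₀ (τ, a, z)) 0 0 := by
      have e1 : (fun a : ℝ => n₀ (τ, a, z)) = fun _ => d z := by funext a; exact hpar a z hz
      rw [e1]; exact hasDerivAt_const _ _
    exact h1.unique h2
  /- the sonic literal -/
  obtain ⟨A, B, hAB⟩ := hson
  have hRev : ∀ z' : ℝ, |z'| < δ' → (R τ) =ᶠ[𝓝 z'] fun z'' => A + B * z'' := by
    intro z' hz'
    filter_upwards [hI.mem_nhds (hImem hz')] with z'' hz'' using hAB z'' (hIabs hz'')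
  have hlinB : ∀ z' : ℝ, HasDerivAt (fun z'' : ℝ => A + B * z'') B z' := fun z' => by
    simpa using ((hasDerivAt_id z').const_mul B).const_add A
  have hR' : ∀ z' : ℝ, |z'| < δ' → deriv (R τ) z' = B := fun z' hz' => by rw [(hRev z' hz').deriv_eq, (hlinB z').deriv]
  have hR'' : deriv (deriv (R τ)) z = 0 := by
    have hev1 : deriv (R τ) =ᶠ[𝓝 z] fun _ => B := by
      filter_upwards [(hRev z hz).eventuallyEq_nhds] with z'' hz''
      rw [hz''.deriv_eq, (hlinB z'').deriv]
    rw [hev1.deriv_eq, deriv_const]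
  /- (ii) the characteristic relation at `z` -/
  have hQ0 : deriv d z ^ 2 + μ (-1 + τ) z = 0 := by
    obtain ⟨-, -, -, -, -, hκ, -, hH⟩ := hpack (τ, (0 : ℝ), z) hτ hz
    simp only at hH hκ
    rw [hns, hR'', (hdd z hz).deriv] at *
    have h2 : κt τ z * (fderiv ℝ n₀ (τ, 0, z) (0, 0, 1) ^ 2 + μ (-1 + τ) z) = 0 := by nlinarith [hH]
    rcases mul_eq_zero.1 h2 with h3 | h3
    · exact absurd h3 hκ.ne'
    · exact h3
  /- (iii) the gradient along the sheet -/
  have hσσ : σ * σ = 1 := by rcases hσ with h | h <;> simp [h]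
  have hgrad : ∀ s' z' : ℝ, |z'| < δ' → ∀ w : EuclideanSpace ℝ (Fin 3),
      fderiv ℝ θ (s' • e + d z' • Jvec e + z' • e2) w = σ * B * w 2 := by
    intro s' z' hz'a
    obtain ⟨-, -, -, hhor, -, -, -, -⟩ := hpack (τ, s', z') hτ hz'a
    simp only at hhor
    rw [hWeq s' z' hz'a] at hhor
    set W' := s' • e + d z' • Jvec e + z' • e2 with hW'
    set nz := fderiv ℝ n₀ (τ, s', z') ((0 : ℝ), (0 : ℝ), (1 : ℝ)) with hnz
    have hP : HasDerivAt (fun a : ℝ => frameCLM e (s', n₀ (τ, s', a), a)) (frameCLM e ((0 : ℝ), nz, (1 : ℝ))) z' := by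
      have hin : HasDerivAt (fun a : ℝ => ((s', n₀ (τ, s', a), a) : ℝ × ℝ × ℝ)) ((0 : ℝ), nz, (1 : ℝ)) z' :=
        (hasDerivAt_const z' s').prodMk ((hdz s' z' hz'a).prodMk (hasDerivAt_id z'))
      exact (frameCLM e).hasFDerivAt.comp_hasDerivAt z' hin
    have hPz : frameCLM e (s', n₀ (τ, s', z'), z') = W' := by rw [hW', ← hWeq s' z' hz'a]
    have hg : HasDerivAt (fun a : ℝ => σ * U t (frameCLM e (s', n₀ (τ, s', a), a)) 2) (σ * fderiv ℝ θ W' (frameCLM e ((0 : ℝ), nz, (1 : ℝ)))) z' := by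
      have h := ((hθd _).hasFDerivAt.comp_hasDerivAt z' hP).const_mul σ
      rw [hPz] at h
      exact h
    have hev : (fun a : ℝ => σ * U t (frameCLM e (s', n₀ (τ, s', a), a)) 2) =ᶠ[𝓝 z'] fun a => A + B * a := by
      filter_upwards [hI.mem_nhds (hImem hz'a)] with a ha
      have hval := (hpack (τ, s', a) hτ (hIabs ha)).2.1
      simp only at hval
      rw [hval, hAB a (hIabs ha)]
    have hBeq : σ * fderiv ℝ θ W' (frameCLM e ((0 : ℝ), nz, (1 : ℝ))) = B := hg.unique ((hlinB z').congr_of_eventuallyEq hev)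
    have hvert : fderiv ℝ θ W' e2 = σ * B := by
      rw [frameCLM_apply] at hBeq
      simp only [zero_smul, zero_add, one_smul, map_add, map_smul, smul_eq_mul] at hBeq
      rw [hhor (Jvec e) (by simp [Jvec]), mul_zero, zero_add] at hBeq
      rw [← hBeq, ← mul_assoc, hσσ, one_mul]
    intro w
    have hsplit : w = (w - w 2 • e2) + w 2 • e2 := by abel
    have hw0 : (w - w 2 • e2) 2 = 0 := by simp [e2]
    rw [hsplit, map_add, hhor _ hw0, map_smul, hvert, smul_eq_mul, zero_add]
    simp [e2, mul_comm]
  /- (iv) the null tangent `e`, (v) the normal curvature -/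
  set c : EuclideanSpace ℝ (Fin 3) →L[ℝ] ℝ := (σ * B) • (EuclideanSpace.proj (𝕜 := ℝ) (2 : Fin 3)) with hc_def
  have hconst : ∀ᶠ q in 𝓝 ((s, z) : ℝ × ℝ), fderiv ℝ θ (webMap e (fun q : ℝ × ℝ => d q.2) q) = c := by
    have hmem : {q : ℝ × ℝ | q.2 ∈ I} ∈ 𝓝 ((s, z) : ℝ × ℝ) := continuous_snd.continuousAt.preimage_mem_nhds (hI.mem_nhds (hImem hz))
    filter_upwards [hmem] with q hq
    ext w
    rw [show webMap e (fun q : ℝ × ℝ => d q.2) q = q.1 • e + d q.2 • Jvec e + q.2 • e2 from rfl, hgrad q.1 q.2 (hIabs hq) w]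
    simp [hc_def]
  have hnull := nonhot_sheet_null_tangents hθ2 e (p := (s, z)) (hdd z hz).differentiableAt hconst
  have hee : ∀ w, fderiv ℝ (fderiv ℝ θ) (s • e + d z • Jvec e + z • e2) e w = 0 := fun w => by
    simpa [webMap] using hnull.2.1 w
  have hTT : ∀ w, fderiv ℝ (fderiv ℝ θ) (s • e + d z • Jvec e + z • e2) (deriv d z • Jvec e + e2) w = 0 := fun w => by
    simpa [webMap] using hnull.2.2 w
  have hWz := hWeq s z hz
  /- (vii) the transport law along the web at time `t` -/
  have htρ : |t + 1| < ρ := by rw [ht_def]; simpa using lt_of_lt_of_le hτ hδ'ρ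
  have hIρ : ∀ z' ∈ I, |z'| < ρ := fun z' hz' => lt_of_lt_of_le (hIabs hz') hδ'ρ
  have hU2 : ContDiff ℝ 2 (U t) := hUan.contDiff.of_le le_top
  have hμfun : μ t = uncurry μ ∘ fun z : ℝ => (t, z) := by funext z; rfl
  have hμd : ∀ z ∈ I, DifferentiableAt ℝ (μ t) z := fun z _ => by
    rw [hμfun]; exact ((hμ3.differentiable (by norm_num)) _).comp z ((differentiableAt_const _).prodMk differentiableAt_id)
  have hplane : ∀ z : ℝ, |z| < ρ → ∀ y : EuclideanSpace ℝ (Fin 3), y 2 = z → ∀ b : Fin 3, b ≠ 2 →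
      fderiv ℝ (U t) y (EuclideanSpace.single 2 (1 : ℝ)) b = μ t z * fderiv ℝ (U t) y (EuclideanSpace.single b (1 : ℝ)) 2 := by
    intro z hz y hy b hb
    have h := hslabU t htρ y (by rw [hy]; exact hz) b hb
    rw [hy] at h; exact h
  have hlawI : ∀ x : EuclideanSpace ℝ (Fin 3), x 2 ∈ I →
      fderiv ℝ (fun y => fderiv ℝ θ y (EuclideanSpace.single 2 (1 : ℝ))) x (EuclideanSpace.single 2 (1 : ℝ)) =
        -μ t (x 2) * (fderiv ℝ (fun y => fderiv ℝ θ y (EuclideanSpace.single 0 (1 : ℝ))) x (EuclideanSpace.single 0 (1 : ℝ)) +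
          fderiv ℝ (fun y => fderiv ℝ θ y (EuclideanSpace.single 1 (1 : ℝ))) x (EuclideanSpace.single 1 (1 : ℝ))) := fun x hx =>
    plane_wave_identity hU2 (fun y => div_coord (hdiv t ht) y) (hplane (x 2) (hIρ _ hx)) rfl
  have hwebI : ∀ s : ℝ, ∀ z ∈ I, fderiv ℝ θ (s • e + d z • Jvec e + z • e2) (Jvec e) = 0 := by
    intro s' z' hz'
    rw [hgrad s' z' (hIabs hz') (Jvec e)]
    simp [Jvec]
  have hd : ContDiffOn ℝ ∞ d I := by
    intro z' hz'
    have h := (hpack (τ, (0 : ℝ), z') hτ (hIabs hz')).2.2.2.2.1 ⊤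
    have hline : ContDiff ℝ ∞ (fun a : ℝ => ((τ, (0 : ℝ), a) : ℝ × ℝ × ℝ)) :=
      contDiff_const.prodMk (contDiff_const.prodMk contDiff_id)
    exact (h.comp z' hline.contDiffAt).contDiffWithinAt
  have hQ0I : ∀ z' ∈ I, deriv d z' ^ 2 + μ t z' = 0 := by
    -- the same computation as `hQ0`, at every point of the window
    intro z' hz'
    have hz'a := hIabs hz'
    have hns' : fderiv ℝ n₀ (τ, (0 : ℝ), z') ((0 : ℝ), (1 : ℝ), (0 : ℝ)) = 0 := by
      have h1 : HasDerivAt (fun a : ℝ => n₀ (τ, a, z')) (fderiv ℝ n₀ (τ, (0 : ℝ), z') ((0 : ℝ), (1 : ℝ), (0 : ℝ))) 0 :=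
        (hn₀d 0 z' hz'a).hasFDerivAt.comp_hasDerivAt (0 : ℝ) (hasDerivAt_sLine τ z' 0)
      have h2 : HasDerivAt (fun a : ℝ => n₀ (τ, a, z')) 0 0 := by
        have e1 : (fun a : ℝ => n₀ (τ, a, z')) = fun _ => d z' := by funext a; exact hpar a z' hz'a
        rw [e1]; exact hasDerivAt_const _ _
      exact h1.unique h2
    have hR''z : deriv (deriv (R τ)) z' = 0 := by
      have hev1 : deriv (R τ) =ᶠ[𝓝 z'] fun _ => B := by
        filter_upwards [(hRev z' hz'a).eventuallyEq_nhds] with z'' hz''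
        rw [hz''.deriv_eq, (hlinB z'').deriv]
      rw [hev1.deriv_eq, deriv_const]
    obtain ⟨-, -, -, -, -, hκ, -, hH⟩ := hpack (τ, (0 : ℝ), z') hτ hz'a
    simp only at hH hκ
    rw [hns', hR''z, (hdd z' hz'a).deriv] at *
    have h2 : κt τ z' * (fderiv ℝ n₀ (τ, 0, z') (0, 0, 1) ^ 2 + μ (-1 + τ) z') = 0 := by nlinarith [hH]
    rcases mul_eq_zero.1 h2 with h3 | h3
    · exact absurd h3 hκ.ne'
    · exact h3
  have htr : HasDerivAt (fun z' : ℝ => deriv d z' * (fderiv ℝ (fderiv ℝ θ) (s • e + d z' • Jvec e + z' • e2) (Jvec e) (Jvec e)) ^ 2) 0 z :=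
    transport_on_characteristic_sheet hθ hI hμd hd he2 hunit hlawI hwebI hQ0I s (hImem hz)
  /- (viii) value and `∂_zU_h = 0` at `W` -/
  have hval : U t (frameCLM e (s, n₀ (τ, s, z), z)) 2 = σ * R τ z := by
    have h := (hpack (τ, s, z) hτ hz).2.1
    simp only at h
    have h2 : σ * (σ * U t (frameCLM e (s, n₀ (τ, s, z), z)) 2) = σ * R τ z := by rw [h]
    rw [← mul_assoc, hσσ, one_mul] at h2
    exact h2
  have hW2 : (frameCLM e (s, n₀ (τ, s, z), z)) 2 = z := by rw [frameCLM_apply_two he2]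
  have hUd : Differentiable ℝ (U t) := hU2.differentiable (by norm_num)
  have hcoord : ∀ w : EuclideanSpace ℝ (Fin 3), fderiv ℝ (U t) (frameCLM e (s, n₀ (τ, s, z), z)) w 2 = fderiv ℝ θ (frameCLM e (s, n₀ (τ, s, z), z)) w := by
    intro w
    have h := ((EuclideanSpace.proj (𝕜 := ℝ) (2 : Fin 3)).hasFDerivAt.comp _ (hUd (frameCLM e (s, n₀ (τ, s, z), z))).hasFDerivAt).fderiv
    have e3 : (⇑(EuclideanSpace.proj (𝕜 := ℝ) (2 : Fin 3)) ∘ U t) = θ := by funext y; simp [hθ_def]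
    rw [e3] at h
    rw [h]; rfl
  have hzero : ∀ b : Fin 3, b ≠ 2 → fderiv ℝ (U t) (frameCLM e (s, n₀ (τ, s, z), z)) (EuclideanSpace.single 2 1) b = 0 := by
    intro b hb
    obtain ⟨-, -, -, hhor, -, -, -, -⟩ := hpack (τ, s, z) hτ hz
    simp only at hhor
    rw [hslabU t htρ _ (by rw [hW2]; exact lt_of_lt_of_le hz hδ'ρ) b hb, hcoord, hhor _ (by simp [hb]), mul_zero]
  refine ⟨hWz, hQ0, fun w => ?_, fun w => ?_, fun w => ?_, ?_, ?_, hval, hzero⟩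
  · rw [hWz, hgrad s z hz w, hR' z hz]
  · rw [hWz]; exact hee w
  · rw [hWz]; exact hTT w
  · obtain ⟨-, -, -, -, -, -, hridge, -⟩ := hpack (τ, s, z) hτ hz
    simp only at hridge
    rw [fderiv_fderiv_const_mul_apply hθ2 σ _ e e, fderiv_fderiv_const_mul_apply hθ2 σ _ (Jvec e) (Jvec e), hWz, hee e, mul_zero,
      zero_add] at hridge
    rw [hWz]; exact hridge
  · exact htr

end Summit.NavierStokesRegularity.NavierStokesRegularity.Theorems.PoloidalWindowDoorLrcModEntireQ4SonicSheetDataPackage
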